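import Literature.RingTheory.CohomologyAnnihilator.StrongGeneratorFiltration
import Literature.RingTheory.CohomologyAnnihilator.ReductionModRegular
import Literature.RingTheory.CohomologyAnnihilator.StrongGeneratorReduction
import Mathlib.RingTheory.KrullDimension.NonZeroDivisors
import Mathlib.RingTheory.KrullDimension.Zero
import HarnessLib

/-!
# Strong generation of `Ωᵈ(mod R)` from cohomology annihilators (Iyengar–Takahashi, Theorem 5.2)

Topic: `Literature/RingTheory/CohomologyAnnihilator`. [IyengarTakahashi2014, Theorem 5.2]:
*Let `R` be a commutative noetherian ring of Krull dimension `d`. If for each prime ideal `𝔭` in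
`R` there exists an integer `s ≤ dim R/𝔭 + 1` such that `caˢ(R/𝔭) ≠ 0`, then there exist a
`G` in `mod R` and an integer `n` such that `Ω^d_R(mod R) ⊆ |G|ₙ`.* The paper proves
Theorem 5.1 (fixed `s`, conclusion for `Ω^{s+d-1}`) and states that "under stronger hypotheses,
the argument in the proof of the theorem above gives" 5.2. This file carries out that argument
(induction on `d`) in the vocabulary of `StrongGenerator.lean`, as the theorem
`exists_strongGenerator_of_forall_prime` whose statement is VERBATIM the hypothesis `h₅₂` of
`singEqVCa_essFiniteType_of_inputs` (`StrongGeneratorReduction.lean`), so that it discharges that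
input of Theorem 5.4 by `exact`.

Proof (adapting the printed proof of 5.1, with `s_𝔭 = dim R/𝔭 + 1`), by strong induction on
`d`:
* the hypothesis passes to every quotient ring `R/I` (`forall_quotient_prime_of_forall_prime`:
  `(R/I)/𝔮 ≅ R/𝔮'`), so by the gluing along a prime filtration
  (`exists_generator_of_forall_prime`, the non-domain step) and raising of the syzygy degree
  (`exists_generator_isSyzygy_of_le`, `dim R/𝔭 ≤ d`) it suffices to treat DOMAINS `S` of
  dimension `d` satisfying the hypothesis (`exists_generator_of_isDomain`);
* for a domain, `𝔭 = 0` gives `0 ≠ a ∈ ca^{d+1}(S)`; if `a` is a unit (in particular if `d = 0`,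
  when `S` is a field) then `ca^{d+1}(S) = S` and `Ωᵈ(mod S) ⊆ |S|₁`
  (`exists_generator_of_cohomologyAnnihilatorOfDegree_eq_top`); otherwise `d = e + 1`,
  `dim S/aS ≤ e`, the induction hypothesis and degree raising give `Ωᵉ(mod S/aS) ⊆ |G|ₙ`, and
  the DOMAIN STEP `exists_generator_of_quotient_regular` concludes: for `M ∈ mod S` and
  `N = Ω^{e+1}_S M = Ωᵉ_S(Ω_S M)`, [DaoTakahashi2014, Lemma 5.6] (`IsSyzygy.quotSMulTop`) gives
  `N/aN = Ωᵉ_{S/aS}(Ω_S M / a Ω_S M) ∈ |G ⊕ S/aS|ₙ₊₁` (Schanuel absorbs the projective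
  discrepancy), hence `N/aN ∈ |G|_S ⊕ S/aS|ₙ₊₁` over `S`; `a ∈ ca^{e+2}(S)` kills
  `Ext¹_S(N, −) ≅ Ext^{e+2}_S(M, −)` and is `N`-regular, so by Remark 2.12
  (`exists_retract_isSyzygy_quotSMulTop`) `N` is a direct summand of `Ω_S(N/aN)`, which lies in
  `|D|ₙ₊₁` for the generator `D` of first syzygies of that tower
  (`exists_generator_isSyzygy_inTower`).

## References

* S. B. Iyengar, R. Takahashi, *Annihilation of cohomology and strong generation of module
  categories*, IMRN 2016; arXiv:1404.1476 — Theorems 5.1, 5.2, Remark 2.12.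
  [`IyengarTakahashi2014`]
* H. Dao, R. Takahashi, *The radius of a subcategory of modules*, Algebra Number Theory 8 (2014),
  Lemma 5.6, Corollary 5.5. [`DaoTakahashi2014`]
-/

noncomputable section

open CategoryTheory CategoryTheory.Limits
open scoped Pointwise nonZeroDivisors

universe u

namespace Literature.RingTheory.CohomologyAnnihilator

variable {R : Type u} [CommRing R]

/-! ## `N/aN` over `R/aR`, restricted back to `R` -/

/-- The `R/aR`-module `N/aN`, viewed as an `R`-module by restriction of scalars, is (by the
identity map) the `R`-module `N/aN`. [folklore] -/
private theorem nonempty_restrictScalars_quotSMulTop_iso (a : R) (N : Type u) [AddCommGroup N]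
    [Module R N] :
    Nonempty ((restrictScalarsFunctor R (R ⧸ Ideal.span {a})).obj
        (ModuleCat.of (R ⧸ Ideal.span {a}) (N ⧸ (a • ⊤ : Submodule R N))) ≅
      ModuleCat.of R (N ⧸ (a • ⊤ : Submodule R N))) :=
  ⟨LinearEquiv.toModuleIso
    { toFun := fun x => x
      map_add' := fun _ _ => rfl
      map_smul' := fun _ _ => rfl
      invFun := fun x => x
      left_inv := fun _ => rfl
      right_inv := fun _ => rfl }⟩

/-! ## The domain step of the proof of Theorem 5.1 -/

/-- **The domain step of the proof of [IyengarTakahashi2014, Theorem 5.1]** (with the parameters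
of Theorem 5.2): let `R` be a noetherian domain, `0 ≠ a ∈ ca^{e+2}(R)`, and suppose
`Ωᵉ(mod R/aR) ⊆ |G|ₙ` for a finitely generated `R/aR`-module `G`. Then
`Ω^{e+1}(mod R) ⊆ |D|ₙ₊₁` for some finitely generated `R`-module `D`. As printed: for
`M ∈ mod R` and `N = Ω^{e+1}_R M`, `N/aN ≅ Ωᵉ_{R/aR}(Ω_R M/aΩ_R M)` [DaoTakahashi2014, Lemma 5.6]
lies in `|G|ₙ` (viewing `G` as an `R`-module; here: in `|G ⊕ R/aR|ₙ₊₁`, Schanuel), `a` kills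
`Ext¹_R(N, −) ≅ Ext^{e+2}_R(M, −)` and is a non-zerodivisor on the syzygy module `N`, so by
Remark 2.12 `N` is a direct summand of `Ω_R(N/aN)`, which lies in the tower of a fixed finitely
generated module. [cite: IyengarTakahashi2014, Thm. 5.1 (proof)] -/
theorem exists_generator_of_quotient_regular [IsNoetherianRing R] [IsDomain R] {e : ℕ} {a : R}
    (ha0 : a ≠ 0) (ha : a ∈ cohomologyAnnihilatorOfDegree R (e + 2))
    (hgen : ∃ G : ModuleCat.{u} (R ⧸ Ideal.span {a}), Module.Finite (R ⧸ Ideal.span {a}) G ∧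
      ∃ n : ℕ, ∀ M : ModuleCat.{u} (R ⧸ Ideal.span {a}), Module.Finite (R ⧸ Ideal.span {a}) M →
        ∃ K : ModuleCat.{u} (R ⧸ Ideal.span {a}), IsSyzygy e M K ∧ InTower G n K) :
    ∃ G : ModuleCat.{u} R, Module.Finite R G ∧ ∃ n : ℕ, ∀ M : ModuleCat.{u} R,
      Module.Finite R M → ∃ K : ModuleCat.{u} R, IsSyzygy (e + 1) M K ∧ InTower G n K := by
  obtain ⟨G', hG', n', hgen'⟩ := hgen
  haveI := hG'
  -- enlarge the generator by `R/aR`, so that finitely generated projectives lie in `add`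
  let G'' : ModuleCat.{u} (R ⧸ Ideal.span {a}) :=
    ModuleCat.of (R ⧸ Ideal.span {a}) (G' × (R ⧸ Ideal.span {a}))
  haveI : Module.Finite (R ⧸ Ideal.span {a}) G'' := Module.Finite.prod
  haveI : Module.Finite R ((restrictScalarsFunctor R (R ⧸ Ideal.span {a})).obj G'') :=
    finite_restrictScalars_of_surjective Ideal.Quotient.mk_surjective _
  -- `D`: a generator for first `R`-syzygies of modules in `|G''|_R|ₙ`
  obtain ⟨D, hD, hDgen⟩ :=
    exists_generator_isSyzygy_inTower ((restrictScalarsFunctor R (R ⧸ Ideal.span {a})).obj G'') 1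
  refine ⟨D, hD, n' + 1, fun M hM => ?_⟩
  haveI := hM
  have ha' : a ∈ R⁰ := mem_nonZeroDivisors_of_ne_zero ha0
  -- `N = Ω^{e+1} M = Ωᵉ(Ω M)`
  obtain ⟨X₁, hX₁⟩ := exists_isSyzygy_one M
  haveI : Module.Finite R X₁ := by
    obtain ⟨P, hP, -, f, g, w, hS⟩ := isSyzygy_one_iff.mp hX₁
    haveI := hP
    exact Module.Finite.of_injective f.hom hS.moduleCat_injective_f
  obtain ⟨N, hNfin, hN⟩ := exists_isSyzygy X₁ e
  haveI := hNfin
  have hMN : IsSyzygy (e + 1) M N := isSyzygy_succ_iff_exists_first.mpr ⟨X₁, hX₁, hN⟩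
  -- `a` is regular on `X₁ ⊆ P`
  have hregX₁ : IsSMulRegular X₁ a := by
    obtain ⟨P, _, hproj, f, g, w, hS⟩ := isSyzygy_one_iff.mp hX₁
    exact isSMulRegular_of_injective f.hom hS.moduleCat_injective_f
      (isSMulRegular_of_projective ha' P hproj)
  -- Lemma 5.6: `N/aN = Ωᵉ_{R/aR}(X₁/aX₁)` and `a` is regular on `N`
  obtain ⟨hNq, hregN⟩ := hN.quotSMulTop ha' hregX₁
  haveI := isScalarTower_quotSMulTop a X₁
  haveI : Module.Finite (R ⧸ Ideal.span {a}) (X₁ ⧸ (a • ⊤ : Submodule R X₁)) :=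
    Module.Finite.of_restrictScalars_finite R _ _
  obtain ⟨Kbar, hKbar, hKbarT⟩ :=
    hgen' (ModuleCat.of (R ⧸ Ideal.span {a}) (X₁ ⧸ (a • ⊤ : Submodule R X₁))) inferInstance
  -- Schanuel: `N/aN ⊕ P₂ ≅ K̄ ⊕ P₁`, so `N/aN ∈ |G''|ₙ₊₁`
  obtain ⟨P₁, P₂, hP₁, hproj₁, -, -, ⟨ε⟩⟩ := hNq.exists_stablyIso hKbar
  have h1 : InTower G'' (n' + 1) (ModuleCat.of (R ⧸ Ideal.span {a}) (Kbar × P₁)) :=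
    ((hKbarT.mono_gen (isRetractOfPower_fst _ _)).succ).prod_of_isRetractOfPower (Nat.succ_pos _)
      (IsRetractOfPower.of_projective (isRetractOfPower_snd _ _) hP₁ hproj₁)
  have h3 : InTower G'' (n' + 1)
      (ModuleCat.of (R ⧸ Ideal.span {a}) (N ⧸ (a • ⊤ : Submodule R N))) :=
    (h1.of_iso ε.symm).of_retract (ModuleCat.ofHom (LinearMap.inl (R ⧸ Ideal.span {a}) _ P₂))
      (ModuleCat.ofHom (LinearMap.fst (R ⧸ Ideal.span {a}) _ P₂))
      (by apply ModuleCat.hom_ext; exact LinearMap.ext fun _ => rfl)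
  -- restrict scalars to `R`
  obtain ⟨ι⟩ := nonempty_restrictScalars_quotSMulTop_iso a N
  have h4 : InTower ((restrictScalarsFunctor R (R ⧸ Ideal.span {a})).obj G'') (n' + 1)
      (ModuleCat.of R (N ⧸ (a • ⊤ : Submodule R N))) :=
    (InTower.restrictScalars h3).of_iso ι
  -- Remark 2.12: `N` is a retract of `L = Ω_R(N/aN)`, as `a` kills `Ext¹(N, −) = Ext^{e+2}(M, −)`
  have hExt : ∀ Y : ModuleCat.{u} R, Module.Finite R Y →
      ∀ x : Abelian.Ext.{u} N Y 1, a • x = 0 := by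
    intro Y hY x
    haveI := hY
    exact ext_smul_eq_zero_of_isSyzygy (e + 1) hMN Y 1 le_rfl a
      (fun x' => smul_eq_zero_of_mem_cohomologyAnnihilatorOfDegree ha (by omega) x') x
  obtain ⟨L, hL, i, p, hip⟩ := exists_retract_isSyzygy_quotSMulTop hregN hExt
  exact ⟨N, hMN, (hDgen (Nat.succ_pos _) h4 hL).of_retract i p hip⟩

/-! ## The hypothesis of Theorem 5.2 passes to quotient rings -/

/-- If every `R/𝔭` (`𝔭` prime) has `caˢ(R/𝔭) ≠ 0` for some `s ≤ dim R/𝔭 + 1`, then the same holds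
for the quotient ring `R/I`: for a prime `𝔮` of `R/I` with preimage `𝔮'`,
`(R/I)/𝔮 ≅ R/𝔮'` and both the Krull dimension and (non-)vanishing of `caˢ` are invariant under
ring isomorphisms. [cite: IyengarTakahashi2014, Thm. 5.1 (proof)] -/
theorem forall_quotient_prime_of_forall_prime
    (hR : ∀ (𝔭 : Ideal R) [𝔭.IsPrime], ∃ s : ℕ, (s : WithBot ℕ∞) ≤ ringKrullDim (R ⧸ 𝔭) + 1 ∧
      cohomologyAnnihilatorOfDegree (R ⧸ 𝔭) s ≠ ⊥) (I : Ideal R) :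
    ∀ (𝔮 : Ideal (R ⧸ I)) [𝔮.IsPrime], ∃ s : ℕ,
      (s : WithBot ℕ∞) ≤ ringKrullDim ((R ⧸ I) ⧸ 𝔮) + 1 ∧
        cohomologyAnnihilatorOfDegree ((R ⧸ I) ⧸ 𝔮) s ≠ ⊥ := by
  intro 𝔮 _
  let 𝔓 : Ideal R := 𝔮.comap (Ideal.Quotient.mk I)
  have hI𝔓 : I ≤ 𝔓 := fun x hx => by
    change Ideal.Quotient.mk I x ∈ 𝔮
    rw [Ideal.Quotient.eq_zero_iff_mem.mpr hx]
    exact 𝔮.zero_mem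
  have h𝔮 : 𝔮 = 𝔓.map (Ideal.Quotient.mk I) :=
    (Ideal.map_comap_of_surjective _ Ideal.Quotient.mk_surjective 𝔮).symm
  let e : (R ⧸ I) ⧸ 𝔮 ≃+* R ⧸ 𝔓 :=
    (Ideal.quotEquivOfEq h𝔮).trans (DoubleQuot.quotQuotEquivQuotOfLE hI𝔓)
  obtain ⟨s, hs, hne⟩ := hR 𝔓
  refine ⟨s, by rwa [ringKrullDim_eq_of_ringEquiv e], fun h => hne ?_⟩
  rw [← map_ringEquiv_cohomologyAnnihilatorOfDegree e.symm s] at h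
  exact (Ideal.map_eq_bot_iff_of_injective e.symm.injective).mp h

/-! ## Theorem 5.2 -/

/-- `caˢ(R) ≠ 0` is invariant under ring isomorphisms. [folklore] -/
private theorem cohomologyAnnihilatorOfDegree_ne_bot_of_ringEquiv {S : Type u} [CommRing S]
    (e : R ≃+* S) {s : ℕ} (h : cohomologyAnnihilatorOfDegree R s ≠ ⊥) :
    cohomologyAnnihilatorOfDegree S s ≠ ⊥ := fun h' => by
  rw [← map_ringEquiv_cohomologyAnnihilatorOfDegree e s] at h'
  exact h ((Ideal.map_eq_bot_iff_of_injective e.injective).mp h')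

/-- **The domain case of Theorem 5.2** (the heart of the induction): let `S` be a noetherian
domain of Krull dimension `d` such that every `S/𝔭` has `caˢ(S/𝔭) ≠ 0` for some
`s ≤ dim S/𝔭 + 1`, and assume Theorem 5.2 in all dimensions `< d`. Then `Ωᵈ(mod S) ⊆ |G|ₙ`
for some finitely generated `G`. Indeed `𝔭 = 0` yields `0 ≠ a ∈ ca^{d+1}(S)`; if `a` is a unit
(e.g. `d = 0`, `S` a field) then `ca^{d+1}(S) = S` and `Ωᵈ(mod S) ⊆ |S|₁`; otherwise
`d = e + 1`, `dim S/aS ≤ e`, the induction hypothesis (the hypothesis passes to `S/aS`) and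
degree raising give `Ωᵉ(mod S/aS) ⊆ |G|ₙ`, and the domain step
`exists_generator_of_quotient_regular` applies. [cite: IyengarTakahashi2014, Thm. 5.2] -/
theorem exists_generator_of_isDomain (d : ℕ)
    (ih : ∀ e < d, ∀ (T : Type u) [CommRing T] [IsNoetherianRing T], ringKrullDim T = e →
      (∀ (𝔭 : Ideal T) [𝔭.IsPrime], ∃ s : ℕ, (s : WithBot ℕ∞) ≤ ringKrullDim (T ⧸ 𝔭) + 1 ∧
        cohomologyAnnihilatorOfDegree (T ⧸ 𝔭) s ≠ ⊥) →
      ∃ G : ModuleCat.{u} T, Module.Finite T G ∧ ∃ n : ℕ, ∀ M : ModuleCat.{u} T,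
        Module.Finite T M → ∃ K : ModuleCat.{u} T, IsSyzygy e M K ∧ InTower G n K)
    (S : Type u) [CommRing S] [IsDomain S] [IsNoetherianRing S] (hS : ringKrullDim S = d)
    (hyp : ∀ (𝔭 : Ideal S) [𝔭.IsPrime], ∃ s : ℕ, (s : WithBot ℕ∞) ≤ ringKrullDim (S ⧸ 𝔭) + 1 ∧
      cohomologyAnnihilatorOfDegree (S ⧸ 𝔭) s ≠ ⊥) :
    ∃ G : ModuleCat.{u} S, Module.Finite S G ∧ ∃ n : ℕ, ∀ M : ModuleCat.{u} S,
      Module.Finite S M → ∃ K : ModuleCat.{u} S, IsSyzygy d M K ∧ InTower G n K := by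
  -- `𝔭 = 0`: `0 ≠ a ∈ ca^{d+1}(S)`
  obtain ⟨s, hs, hne⟩ := hyp (⊥ : Ideal S)
  rw [ringKrullDim_eq_of_ringEquiv (RingEquiv.quotientBot S), hS] at hs
  have hsd : s ≤ d + 1 := by
    have hs' : ((s : ℕ∞) : WithBot ℕ∞) ≤ ((d + 1 : ℕ) : ℕ∞) := by
      simpa using hs
    exact_mod_cast hs'
  have hne' : cohomologyAnnihilatorOfDegree S (d + 1) ≠ ⊥ := fun h =>
    cohomologyAnnihilatorOfDegree_ne_bot_of_ringEquiv (RingEquiv.quotientBot S) hne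
      (le_bot_iff.mp (h ▸ cohomologyAnnihilatorOfDegree_mono hsd))
  obtain ⟨a, ha, ha0⟩ := (Submodule.ne_bot_iff _).mp hne'
  by_cases hunit : IsUnit a
  · -- `ca^{d+1}(S) = S`
    exact exists_generator_of_cohomologyAnnihilatorOfDegree_eq_top
      (Ideal.eq_top_of_isUnit_mem _ ha hunit)
  -- `a` is a non-unit: `d ≥ 1`
  cases d with
  | zero =>
    exfalso
    haveI : Ring.KrullDimLE 0 S := ringKrullDimZero_iff_ringKrullDim_eq_zero.mpr hS
    obtain ⟨b, hb⟩ := (Ring.KrullDimLE.isField_of_isDomain (R := S)).mul_inv_cancel ha0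
    exact hunit (IsUnit.of_mul_eq_one b hb)
  | succ e =>
    -- `T = S/aS` has dimension `e'' ≤ e` and satisfies the hypothesis
    haveI : Nontrivial (S ⧸ Ideal.span {a}) :=
      Ideal.Quotient.nontrivial_iff.mpr (Ideal.span_singleton_ne_top hunit)
    have ha' : a ∈ S⁰ := mem_nonZeroDivisors_of_ne_zero ha0
    have hdimT := ringKrullDim_quotient_succ_le_of_nonZeroDivisor ha'
    rw [hS] at hdimT
    obtain ⟨e'', he''⟩ : ∃ e'' : ℕ, ringKrullDim (S ⧸ Ideal.span {a}) = e'' :=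
      exists_nat_cast_eq_of_le ringKrullDim_nonneg_of_nontrivial
        (hS ▸ ringKrullDim_quotient_le (Ideal.span {a}))
    rw [he''] at hdimT
    have he''e : e'' ≤ e := by
      have h' : (((e'' + 1 : ℕ) : ℕ∞) : WithBot ℕ∞) ≤ ((e + 1 : ℕ) : ℕ∞) := by
        simpa using hdimT
      have h'' : e'' + 1 ≤ e + 1 := by exact_mod_cast h'
      omega
    have hgenT := ih e'' (by omega) (S ⧸ Ideal.span {a}) he''
      (forall_quotient_prime_of_forall_prime hyp (Ideal.span {a}))
    exact exists_generator_of_quotient_regular ha0 ha (exists_generator_isSyzygy_of_le he''e hgenT)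

/-- **[IyengarTakahashi2014, Theorem 5.2].** Let `R` be a commutative noetherian ring of Krull
dimension `d`. If for each prime ideal `𝔭` of `R` there is an integer `s ≤ dim R/𝔭 + 1` with
`caˢ(R/𝔭) ≠ 0`, then there exist a finitely generated `R`-module `G` and an integer `n` such that
`Ω^d_R(mod R) ⊆ |G|ₙ` (every finitely generated `R`-module has a `d`-th syzygy module in `|G|ₙ`).
The statement is verbatim the hypothesis `h₅₂` of `singEqVCa_essFiniteType_of_inputs`. Proof by
strong induction on `d`: glue along a prime filtration of `R` (`exists_generator_of_forall_prime`)
the generators of the domains `R/𝔭` (`exists_generator_of_isDomain` in dimension `dim R/𝔭 ≤ d`,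
then `exists_generator_isSyzygy_of_le`). [cite: IyengarTakahashi2014, Thm. 5.2] -/
theorem exists_strongGenerator_of_forall_prime :
    ∀ (R : Type u) [CommRing R] [IsNoetherianRing R] (d : ℕ), ringKrullDim R = d →
      (∀ (𝔭 : Ideal R) [𝔭.IsPrime], ∃ s : ℕ, (s : WithBot ℕ∞) ≤ ringKrullDim (R ⧸ 𝔭) + 1 ∧
        cohomologyAnnihilatorOfDegree (R ⧸ 𝔭) s ≠ ⊥) →
      ∃ G : ModuleCat.{u} R, Module.Finite R G ∧ ∃ n : ℕ, ∀ M : ModuleCat.{u} R,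
        Module.Finite R M → ∃ K : ModuleCat.{u} R, IsSyzygy d M K ∧ InTower G n K := by
  intro R _ _ d
  induction d using Nat.strong_induction_on generalizing R with
  | _ d ih =>
  intro hd hyp
  refine exists_generator_of_forall_prime d fun 𝔭 _ => ?_
  haveI : Nontrivial (R ⧸ 𝔭) := Ideal.Quotient.nontrivial_iff.mpr (Ideal.IsPrime.ne_top ‹_›)
  obtain ⟨d', hd'⟩ : ∃ d' : ℕ, ringKrullDim (R ⧸ 𝔭) = d' :=
    exists_nat_cast_eq_of_le ringKrullDim_nonneg_of_nontrivial (hd ▸ ringKrullDim_quotient_le 𝔭)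
  have hd'd : d' ≤ d := by
    have h := ringKrullDim_quotient_le 𝔭
    rw [hd, hd'] at h
    have h' : ((d' : ℕ∞) : WithBot ℕ∞) ≤ ((d : ℕ) : ℕ∞) := by simpa using h
    exact_mod_cast h'
  exact exists_generator_isSyzygy_of_le hd'd
    (exists_generator_of_isDomain d' (fun e he T _ _ hT hT' => ih e (by omega) T hT hT')
      (R ⧸ 𝔭) hd' (forall_quotient_prime_of_forall_prime hyp 𝔭))

end Literature.RingTheory.CohomologyAnnihilator

end
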